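import Literature.Computability.QuantumComplexity.IQPPostselection
import Literature.Computability.QuantumComplexity.IQPSimulationTransfer
import Literature.Computability.QuantumComplexity.PostBQPToPostIQP
import Literature.Computability.QuantumComplexity.SamplerPostselection
import Literature.Computability.QuantumComplexity.PostBPPAmplification
import Literature.Computability.Cryptography.PostselectionProofs
import Literature.Computability.Complexity.PRelHierarchy
import Literature.Computability.Complexity.CookReducibilityTransitive
import Literature.Computability.Complexity.PRelSigmaPi
import Literature.Computability.Complexity.PostBPPDeltaThree
import Literature.Computability.Complexity.TodaPartTwo
import Literature.Computability.Complexity.TodaPartOne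
import Literature.Computability.QuantumComplexity.PostBQPToPostIQPProofs
import HarnessLib

/-!
# BJS Theorem 2 / Corollary 1: assembly of the discharged ingredients

Family `quantum-advantage`. Sibling proof file (D-0014) of `IQPPostselection.lean`,
`IQPSimulationTransfer.lean` and `PostBQPToPostIQP.lean`, which vendor Bremner–Jozsa–Shepherd's
Theorem 2 and Corollary 1 (Proc. R. Soc. A 467 (2011), arXiv:1005.1407) in the corrected, uniform
form `PostBPP_eq_PP_of_uniform_iqp_multiplicative` / `PH_eq_DeltaP_three_of_uniform_iqp_multiplicative`
together with the directed graph of named facts of the printed proofs. Six leaves of that graph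
are now theorems:

* `mem_PostBPPWith_of_samplerPostDecides_holds` (`SamplerPostselection.lean`): the post-selected
  uniform sampler is a post-BPP computation (BJS, proof of Thm. 2, eq. (7) with Def. 3);
* `PostBPPWith_subset_PostBPP_holds` (`PostBPPAmplification.lean`): post-BPP does not depend on
  the error tolerance (BJS §2.4; Han–Hemaspaandra–Thierauf 1997, Thm. 3.1);
* `PostBPP_subset_PP_holds` (`Cryptography/PostselectionProofs.lean`): `PostBPP ⊆ PP`
  (Han–Hemaspaandra–Thierauf 1997, §2 with Thm. 2.3);
* `DeltaP_subset_PH` (`Complexity/PRelHierarchy.lean`): `Δₖᵖ ⊆ PH`, via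
  `Δₖ₊₁ᵖ ⊆ Σₖ₊₂ᵖ ∩ Πₖ₊₂ᵖ` (Stockmeyer 1976, §3, in a two-level form) — this is all that the
  printed proof of Cor. 1 uses of the named fact `DeltaP_succ_subset_SigmaP_inter_PiP`
  (the direction `Δ₃ ⊆ PH` of the equality `PH = Δ₃`);
* `mem_PRel_of_polyTimeTuringReducible_holds` (`Complexity/CookReducibilityTransitive.lean`):
  `P^{P^O} = P^O` (Ladner–Lynch–Selman 1975, §2), giving `P^{P^{Σ₂}} ⊆ P^{Σ₂} = Δ₃`;
* `stockmeyer_DeltaP_succ_subset` (`Complexity/PRelSigmaPi.lean`): the printed one-level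
  inclusion `Δₖ₊₁ ⊆ Σₖ₊₁ ∩ Πₖ₊₁` (Stockmeyer 1976, §3 with Thm. 3.1), which discharges the named
  fact `DeltaP_succ_subset_SigmaP_inter_PiP` of `IQPPostselection.lean`
  (`DeltaP_succ_subset_SigmaP_inter_PiP_holds` below).

This file records the consequences:

* `mem_PostBPP_of_samplesMultiplicative_holds` — **the simulation argument of BJS Theorem 2
  (proof, eqs. (5)–(8)) is now a theorem**: a uniform PPT sampler that is multiplicatively
  `c`-close (`c² < 2 - 2ε`) to the output distribution of a uniform post-IQP family deciding `L`
  with tolerance `ε` puts `L ∈ PostBPP`;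
* `PostBPP_eq_PP_of_uniform_iqp_multiplicative_of_thm1` — BJS Theorem 2 (corrected form) follows
  from BJS Theorem 1 alone (`PP_subset_PostIQPWith`, i.e. Aaronson's `PostBQP = PP`, post-BQP
  error reduction and the Hadamard gadget, cf. `PP_subset_PostIQPWith_of`);
* `PH_eq_DeltaP_three_of_uniform_iqp_multiplicative_of_thm1` — BJS Corollary 1 (corrected S22)
  follows from BJS Theorem 1 and the two deep structural theorems quoted in its printed proof
  that are still named facts: Toda's theorem and `PostBPP ⊆ Δ₃ᵖ` (HHT 1997, Thm. 3.11 (1));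
* `PH_eq_DeltaP_three_of_uniform_iqp_multiplicative_of_remaining_gadget_facts` — the same with
  Theorem 1 split into its three printed steps (five named facts in all: Aaronson's `PostBQP = PP`,
  post-BQP error reduction, the Hadamard gadget, Toda, HHT 1997 Thm. 3.11 (1)).

## Update (2026-08-14, later): `PostBPP ⊆ Δ₃ᵖ` is a theorem

`PostBPP_subset_DeltaP_three_holds` below discharges the named fact `PostBPP_subset_DeltaP_three`
(HHT 1997, Thm. 3.11 (1)) from `Complexity/PostBPPDeltaThree.lean` (with
`PostBPPHashCriterion.lean`, `PostBPPHashLanguage.lean`: Sipser's `Hash` predicate for the products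
`acc(x)^t`, `rej(x)^t` is a `Σ₂ᵖ` language, and the truth-table machine comparing the two hash
indices decides `L`). Hence `PH_eq_DeltaP_three_of_uniform_iqp_multiplicative_of_four_facts`: the
corrected S22 (BJS Cor. 1) follows from four named facts — Aaronson's `PostBQP = PP`, post-BQP
error reduction, the Hadamard gadget, and Toda's theorem.

Moreover the second half of Toda's theorem, `BP·⊕P ⊆ P^{PP}`, is a theorem
(`Complexity/TodaPartTwo.lean`, `bp_ParityP_subset_PRelClass_PP_holds`), so Toda's theorem itself
reduces to its first half `SigmaP_subset_bpExp_ParityP` (`Σₖᵖ ⊆ BP·⊕P`, Arora–Barak Lemma 17.17):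
`toda_PH_subset_PRelClass_PP_of_part1`, and the corrected S22 follows from Aaronson's theorem,
post-BQP error reduction, the Hadamard gadget and Toda's first half
(`PH_eq_DeltaP_three_of_uniform_iqp_multiplicative_of_part1_facts`).

## Update (2026-08-15): Toda's theorem and post-BQP error reduction are theorems

Two more leaves have been discharged elsewhere in the tree: the first half of Toda's theorem,
`Complexity.SigmaP_subset_bpExp_ParityP_holds` (`Complexity/TodaPartOne.lean`, Arora–Barak 2009,
Lemma 17.17), and post-BQP error reduction, `PostBQP_subset_PostBQPWith_holds`
(`PostBQPToPostIQPProofs.lean`, BJS §2.4). Hence: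

* `toda_PH_subset_PRelClass_PP_holds` — **Toda's theorem `PH ⊆ P^{PP}` is a theorem of the
  tree**, discharging the named fact `toda_PH_subset_PRelClass_PP` of `IQPPostselection.lean`
  (`toda_PH_subset_PRelClass_PP_of_part1` with the first half);
* `PP_subset_PostIQPWith_of_subset` — BJS Theorem 1 in the inclusion form consumed downstream
  needs of Aaronson's theorem only the inclusion `PP ⊆ PostBQP` (the printed proof quotes
  `post-BQP = PP` and uses `PP ⊆ post-BQP ⊆ post-IQP`), plus the Hadamard gadget;
* `PostBPP_eq_PP_of_uniform_iqp_multiplicative_of_two_facts` and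
  `PH_eq_DeltaP_three_of_uniform_iqp_multiplicative_of_two_facts` — BJS Theorem 2 and
  Corollary 1 (corrected S22) from exactly **two** remaining hypotheses: `PP ⊆ PostBQP`
  (Aaronson 2005, Thm. 4 of the arXiv text = Thm. 2 of the journal version, the direction proved
  there by a post-selected quantum algorithm for the majority count) and the Hadamard gadget
  `PostBQPWith_subset_PostIQPWith` (BJS Thm. 1).

## References

* M. J. Bremner, R. Jozsa, D. J. Shepherd, *Classical simulation of commuting quantum
  computations implies collapse of the polynomial hierarchy*, Proc. R. Soc. A 467 (2011)
  459–472, arXiv:1005.1407: Thm. 1 (p. 7), Thm. 2 and its proof, eqs. (5)–(8) (p. 8), Cor. 1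
  (p. 8), §2.4 (p. 6), §3.1 eq. (1) (p. 7).
* Y. Han, L. A. Hemaspaandra, T. Thierauf, *Threshold computation and cryptographic security*,
  SIAM J. Comput. 26 (1997) 59–78, §2, Thm. 2.3, Thm. 3.1, Thm. 3.11.
* S. Toda, *PP is as hard as the polynomial-time hierarchy*, SIAM J. Comput. 20 (1991) 865–877.
* L. J. Stockmeyer, *The polynomial-time hierarchy*, Theoret. Comput. Sci. 3 (1976) 1–22, §3.
* R. E. Ladner, N. A. Lynch, A. L. Selman, *A comparison of polynomial time reducibilities*,
  Theoret. Comput. Sci. 1 (1975) 103–123, §2.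
-/

namespace Literature.Computability.QuantumComplexity

open Complexity Cryptography

/-- **Discharge of `DeltaP_succ_subset_SigmaP_inter_PiP`** (`IQPPostselection.lean`): Stockmeyer's
`Δₖ₊₁ᵖ ⊆ Σₖ₊₁ᵖ ∩ Πₖ₊₁ᵖ` for every `k`, from `stockmeyer_DeltaP_succ_subset`
(`Complexity/PRelSigmaPi.lean`). [cite: Stockmeyer1976, §3 (inclusion structure) with Thm. 3.1] -/
theorem DeltaP_succ_subset_SigmaP_inter_PiP_holds : DeltaP_succ_subset_SigmaP_inter_PiP :=
  fun k => stockmeyer_DeltaP_succ_subset k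

/-- **The simulation argument of BJS Theorem 2, proved** (discharge of the named fact
`mem_PostBPP_of_samplesMultiplicative`): if the uniform post-selected IQP family `F` decides `L`
with tolerance `0 < ε < 1/2` and the uniform PPT sampler `A` (exactly polynomial coin budget)
samples `F.kernel` to multiplicative error `c ≥ 1` with `c² < 2 - 2ε`, then `L ∈ PostBPP`.
Assembled from the transfer step (`mem_PostBPP_of_samplesMultiplicative_of`, eq. (8)), the
plumbing step `mem_PostBPPWith_of_samplerPostDecides_holds` (eq. (7) with Def. 3) and post-BPP
error reduction `PostBPPWith_subset_PostBPP_holds` (§2.4).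
(BJS 2011, proof of Thm. 2, eqs. (5)–(8).) [cite: BremnerJozsaShepherdPRSA2011, Thm. 2 (proof, eqs. (5)–(8))] -/
theorem mem_PostBPP_of_samplesMultiplicative_holds : mem_PostBPP_of_samplesMultiplicative :=
  mem_PostBPP_of_samplesMultiplicative_of mem_PostBPPWith_of_samplerPostDecides_holds
    PostBPPWith_subset_PostBPP_holds

/-- **BJS Theorem 2 (corrected, uniform form) from BJS Theorem 1.** If `PP ⊆ PostIQPWith ε` for
all `0 < ε < 1/2` (Thm. 1, named fact `PP_subset_PostIQPWith`), then a uniform multiplicative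
simulation of all uniform IQP families with a constant `c < √2` gives `PostBPP = PP`: the
simulation argument and `PostBPP ⊆ PP` are theorems
(`mem_PostBPP_of_samplesMultiplicative_holds`, `PostBPP_subset_PP_holds`).
(BJS 2011, Thm. 2 and its proof.) [cite: BremnerJozsaShepherdPRSA2011, Thm. 2 (proof)] -/
theorem PostBPP_eq_PP_of_uniform_iqp_multiplicative_of_thm1 (hThm1 : PP_subset_PostIQPWith) :
    PostBPP_eq_PP_of_uniform_iqp_multiplicative :=
  PostBPP_eq_PP_of_uniform_iqp_multiplicative_of_facts hThm1
    mem_PostBPP_of_samplesMultiplicative_holds PostBPP_subset_PP_holds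

/-- **BJS Corollary 1 (corrected S22) from BJS Theorem 1 and the two deep theorems of its printed
proof that are still named facts**: Toda's theorem `PH ⊆ P^PP` and `PostBPP ⊆ Δ₃ᵖ` (HHT 1997,
Thm. 3.11 (1), BJS eq. (1)); the structural steps `P^{P^{Σ₂}} ⊆ P^{Σ₂}` (Ladner–Lynch–Selman 1975)
and `Δ₃ ⊆ PH` (Stockmeyer 1976) are the theorems `PRelClass_PRelClass_subset_self` and
`DeltaP_subset_PH`. Then `PH ⊆ P^PP = P^PostBPP ⊆ P^{Δ₃} = P^{P^{Σ₂}} ⊆ P^{Σ₂} = Δ₃ ⊆ PH`.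
(BJS 2011, proof of Cor. 1 with §3.1 eq. (1).) [cite: BremnerJozsaShepherdPRSA2011, Cor. 1 (proof)] -/
theorem PH_eq_DeltaP_three_of_uniform_iqp_multiplicative_of_thm1
    (hThm1 : PP_subset_PostIQPWith) (hToda : toda_PH_subset_PRelClass_PP)
    (hHHT : PostBPP_subset_DeltaP_three) :
    PH_eq_DeltaP_three_of_uniform_iqp_multiplicative := by
  intro hsim
  have hPP : PostBPP = PP := PostBPP_eq_PP_of_uniform_iqp_multiplicative_of_thm1 hThm1 hsim
  refine Set.Subset.antisymm ?_ (DeltaP_subset_PH 3)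
  calc PH ⊆ PRelClass PP := hToda
    _ = PRelClass PostBPP := by rw [hPP]
    _ ⊆ PRelClass (DeltaP 3) := PRelClass_mono hHHT
    _ = PRelClass (PRelClass (SigmaP 2)) := by rw [DeltaP_three_eq]
    _ ⊆ PRelClass (SigmaP 2) := PRelClass_PRelClass_subset_self _
    _ = DeltaP 3 := DeltaP_three_eq.symm

/-- **The corrected S22 from the remaining open leaves**, with BJS Theorem 1 split into its
printed steps: Aaronson's `PostBQP = PP` (tree fact), post-BQP error reduction
(`PostBQP_subset_PostBQPWith`), the Hadamard gadget (`PostBQPWith_subset_PostIQPWith`); plus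
Toda and HHT 1997 Thm. 3.11 (1). The simulation argument of Thm. 2, `PostBPP ⊆ PP`,
`P^{P^O} = P^O` and `Δ₃ ⊆ PH` no longer appear as hypotheses.
(BJS 2011, Thm. 1, Thm. 2, Cor. 1.) [cite: BremnerJozsaShepherdPRSA2011, Cor. 1 (proof)] -/
theorem PH_eq_DeltaP_three_of_uniform_iqp_multiplicative_of_remaining_gadget_facts
    (hA : PostBQP_eq_PP) (hamp : PostBQP_subset_PostBQPWith)
    (hgadget : PostBQPWith_subset_PostIQPWith) (hToda : toda_PH_subset_PRelClass_PP)
    (hHHT : PostBPP_subset_DeltaP_three) :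
    PH_eq_DeltaP_three_of_uniform_iqp_multiplicative :=
  PH_eq_DeltaP_three_of_uniform_iqp_multiplicative_of_thm1 (PP_subset_PostIQPWith_of hA hamp hgadget)
    hToda hHHT

/-- **The original S22 (`PH_eq_DeltaP_three_of_iqp_multiplicative`, as vendored) from the same
five leaves, for its admissible witnesses**: S22's hypothesis is weaker than BJS's (no coin-budget
clause, family-dependent `c`), so S22 itself does not follow; but every *uniform* witness of
S22's hypothesis in BJS's `∃ c ∀ F` form yields the collapse. Stated as the implication between
the two hypotheses' conclusions that the tree can honestly offer. [cite: BremnerJozsaShepherdPRSA2011, Cor. 1] -/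
theorem PH_eq_DeltaP_three_of_uniformIQPMultiplicativeSimulation
    (hA : PostBQP_eq_PP) (hamp : PostBQP_subset_PostBQPWith)
    (hgadget : PostBQPWith_subset_PostIQPWith) (hToda : toda_PH_subset_PRelClass_PP)
    (hHHT : PostBPP_subset_DeltaP_three)
    (hsim : UniformIQPMultiplicativeSimulation) : PH = DeltaP 3 :=
  PH_eq_DeltaP_three_of_uniform_iqp_multiplicative_of_remaining_gadget_facts hA hamp hgadget hToda
    hHHT hsim


/-- **Discharge of `PostBPP_subset_DeltaP_three`** (HHT 1997, Thm. 3.11 (1): `BPP_path ⊆ P^{Σ₂ᵖ[log]}`,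
hence `PostBPP ⊆ Δ₃ᵖ`): unfold the tree's `PostBPP` (predicates `R, S ∈ P`, coin polynomial `p`,
thresholds `2/3, 1/3` conditioned on `S`) and apply
`Complexity.mem_DeltaP_three_of_postselection` (`Complexity/PostBPPDeltaThree.lean`).
[cite: HanHemaspaandraThierauf1997, Thm. 3.11 (1)] -/
theorem PostBPP_subset_DeltaP_three_holds : PostBPP_subset_DeltaP_three :=
  fun _ ⟨_, hR, _, hS, p, h⟩ => Complexity.mem_DeltaP_three_of_postselection hR hS p h

/-- **The corrected S22 (BJS Cor. 1) from four named facts**: Aaronson's `PostBQP = PP`, post-BQP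
error reduction, the Hadamard gadget (BJS Thm. 1) and Toda's theorem; `PostBPP ⊆ Δ₃ᵖ` is now the
theorem `PostBPP_subset_DeltaP_three_holds`. (BJS 2011, Thm. 1, Thm. 2, Cor. 1.)
[cite: BremnerJozsaShepherdPRSA2011, Cor. 1 (proof)] -/
theorem PH_eq_DeltaP_three_of_uniform_iqp_multiplicative_of_four_facts
    (hA : PostBQP_eq_PP) (hamp : PostBQP_subset_PostBQPWith)
    (hgadget : PostBQPWith_subset_PostIQPWith) (hToda : toda_PH_subset_PRelClass_PP) :
    PH_eq_DeltaP_three_of_uniform_iqp_multiplicative :=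
  PH_eq_DeltaP_three_of_uniform_iqp_multiplicative_of_remaining_gadget_facts hA hamp hgadget hToda
    PostBPP_subset_DeltaP_three_holds


/-- **Toda's theorem from its first half**: with `BP·⊕P ⊆ P^{PP}` proved
(`Complexity.bp_ParityP_subset_PRelClass_PP_holds`, `Complexity/TodaPartTwo.lean`), the named fact
`toda_PH_subset_PRelClass_PP` (`PH ⊆ P^{PP}`) follows from `Σₖᵖ ⊆ BP·⊕P` alone
(`Complexity.SigmaP_subset_bpExp_ParityP`, Arora–Barak 2009, Lemma 17.17).
[cite: AroraBarak2009, Thm. 17.14] -/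
theorem toda_PH_subset_PRelClass_PP_of_part1 (h1 : Complexity.SigmaP_subset_bpExp_ParityP) :
    toda_PH_subset_PRelClass_PP :=
  Complexity.PH_subset_PRelClass_PP_of_parts h1 Complexity.bp_ParityP_subset_PRelClass_PP_holds

/-- **The corrected S22 (BJS Cor. 1) from Aaronson's theorem, post-BQP error reduction, the
Hadamard gadget and the first half of Toda's theorem.** [cite: BremnerJozsaShepherdPRSA2011, Cor. 1 (proof)] -/
theorem PH_eq_DeltaP_three_of_uniform_iqp_multiplicative_of_part1_facts
    (hA : PostBQP_eq_PP) (hamp : PostBQP_subset_PostBQPWith)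
    (hgadget : PostBQPWith_subset_PostIQPWith) (h1 : Complexity.SigmaP_subset_bpExp_ParityP) :
    PH_eq_DeltaP_three_of_uniform_iqp_multiplicative :=
  PH_eq_DeltaP_three_of_uniform_iqp_multiplicative_of_four_facts hA hamp hgadget
    (toda_PH_subset_PRelClass_PP_of_part1 h1)

/-! ### Update (2026-08-15): Toda's theorem; the corrected S22 from two hypotheses -/

/-- **Toda's theorem `PH ⊆ P^{PP}`, proved** (discharge of the named fact
`toda_PH_subset_PRelClass_PP` of `IQPPostselection.lean`): both halves of the printed proof are
theorems of the tree — `Σₖᵖ ⊆ BP·⊕P` (`Complexity.SigmaP_subset_bpExp_ParityP_holds`,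
`Complexity/TodaPartOne.lean`; Arora–Barak 2009, Lemma 17.17) and `BP·⊕P ⊆ P^{PP}`
(`Complexity.bp_ParityP_subset_PRelClass_PP_holds`, `Complexity/TodaPartTwo.lean`; Arora–Barak
2009, proof of Thm. 17.14 from Lemma 17.22) — assembled by `toda_PH_subset_PRelClass_PP_of_part1`.
(Toda 1991, Main Theorem; Arora–Barak 2009, Thm. 17.14: "PROOF OF THEOREM 17.14 USING LEMMAS 17.17
AND 17.22".) [cite: Toda1991, Main Theorem] [cite: AroraBarak2009, Thm. 17.14] -/
theorem toda_PH_subset_PRelClass_PP_holds : toda_PH_subset_PRelClass_PP :=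
  toda_PH_subset_PRelClass_PP_of_part1 Complexity.SigmaP_subset_bpExp_ParityP_holds

/-- **BJS Theorem 1 (inclusion form) from `PP ⊆ PostBQP` and the Hadamard gadget.** For
`0 < ε < 1/2`: `PP ⊆ PostBQP ⊆ PostBQPWith ε ⊆ PostIQPWith ε`, the middle step being the theorem
`PostBQP_subset_PostBQPWith_holds` (post-BQP error reduction, BJS §2.4). Of Aaronson's
`PostBQP = PP` only the inclusion `PP ⊆ PostBQP` is consumed by the printed proof ("post-IQP ⊆
post-BQP and we show the reverse inclusion … we obtain post-BQP as the class of languages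
decidable with bounded error", then `post-BQP = PP`). (BJS 2011, proof of Thm. 1 with §2.4;
Aaronson 2005, Thm. 4 of arXiv:quant-ph/0412187, `PP ⊆ PostBQP`.) [cite: BremnerJozsaShepherdPRSA2011, Thm. 1 (proof)] -/
theorem PP_subset_PostIQPWith_of_subset (h : PP ⊆ PostBQP)
    (hgadget : PostBQPWith_subset_PostIQPWith) : PP_subset_PostIQPWith :=
  fun ε hε0 hε1 _ hL => hgadget ε (PostBQP_subset_PostBQPWith_holds ε hε0 hε1 (h hL))

/-- **BJS Theorem 2 (corrected, uniform form) from two hypotheses**: `PP ⊆ PostBQP` (Aaronson)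
and the Hadamard gadget (BJS Thm. 1); the simulation argument, `PostBPP ⊆ PP` and post-BQP error
reduction are theorems. (BJS 2011, Thm. 2 and its proof.) [cite: BremnerJozsaShepherdPRSA2011, Thm. 2 (proof)] -/
theorem PostBPP_eq_PP_of_uniform_iqp_multiplicative_of_two_facts (h : PP ⊆ PostBQP)
    (hgadget : PostBQPWith_subset_PostIQPWith) : PostBPP_eq_PP_of_uniform_iqp_multiplicative :=
  PostBPP_eq_PP_of_uniform_iqp_multiplicative_of_thm1 (PP_subset_PostIQPWith_of_subset h hgadget)

/-- **The corrected S22 (BJS Corollary 1) from two hypotheses**: `PP ⊆ PostBQP` (Aaronson 2005)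
and the Hadamard gadget `PostBQPWith ε ⊆ PostIQPWith ε` (BJS Thm. 1). Everything else in the
printed proof of Cor. 1 — Thm. 2's simulation argument, `PostBPP ⊆ PP`, post-BQP error reduction,
Toda's theorem (`toda_PH_subset_PRelClass_PP_holds`), `PostBPP ⊆ Δ₃ᵖ` (HHT 1997), `P^{P^{Σ₂}} ⊆
P^{Σ₂}` and `Δ₃ ⊆ PH` — is a theorem of the tree. (BJS 2011, Cor. 1 and its proof: "Toda's
theorem with eq. (1) gives `PH ⊆ P^{PP} = P^{post-BPP} ⊆ Δ₃`".) [cite: BremnerJozsaShepherdPRSA2011, Cor. 1 (proof)] -/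
theorem PH_eq_DeltaP_three_of_uniform_iqp_multiplicative_of_two_facts (h : PP ⊆ PostBQP)
    (hgadget : PostBQPWith_subset_PostIQPWith) :
    PH_eq_DeltaP_three_of_uniform_iqp_multiplicative :=
  PH_eq_DeltaP_three_of_uniform_iqp_multiplicative_of_thm1 (PP_subset_PostIQPWith_of_subset h hgadget)
    toda_PH_subset_PRelClass_PP_holds PostBPP_subset_DeltaP_three_holds

end Literature.Computability.QuantumComplexity
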